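import Summits.Ventures.WeilGRH.KeyMinorant
import Summits.Ventures.WeilGRH.KeySectionToTestZeta
import HarnessLib

/-!
# GRH arm (rh-explicit, venture WeilGRH): the section → test transfer ON THE SAME WINDOW (dilation of
  continuous window functions) — pseudo-key certificates reach `t = log(N+1)/2` itself

Cell `rh-explicit`, WEIL TRACK (lit/typing seat weil-grh-5; sequel of `KeySectionToTest.lean` (A33),
`KeySectionToTestZeta.lean` (A34) and `KeyMinorant.lean` (A35)).

The transfer of A33/A34 smooths a window function `u` on `[-b, b]` by bump mollifiers, which enlarges the support:
its conclusions live on windows `t > b`.  For a window function that is Lipschitz on all of `ℝ` (equivalently: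
continuous, `u(±b) = 0` — e.g. `|g|` of a test function `g`, the input of the minorant A35) the loss is removed
by a DILATION first: `u_i(x) = u(c_i x)`, `c_i = 1 + 1/(i+1) ↓ 1`, is a window function on the strictly smaller
window `[-b/c_i, b/c_i]`, and `u_i → u` uniformly with uniform sup and Lipschitz bounds, so every key form and
the `ζ` window form converge along the family (`tendsto_keyMarkovForm_of_uniform`, from weil-grh-1's
`tendsto_weilTwistIncrement_of_uniform` / `tendsto_archIntegralPar_of_uniform`, and weil-2's
`tendsto_weilWindowForm_of_uniform`).  Results (all at the SAME window `b`):
* `exists_isWeilTest_keyMarkovForm_lt_of_lipschitz`: `keyMarkovForm a L v b u < B‖u‖₂²` ⇒ a TEST function `g` on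
  `[-b, b]` with `keyMarkovForm a L v b g < B‖g‖₂²`; `not_weilPositivityOnKey_of_lipschitz`,
  `keyMarkovForm_nonneg_of_weilPositivityOnKey_of_lipschitz` (`t ≤ log(N+1)/2`, not `<`);
* ★★ `weilPositivityOnChar_of_weilPositivityOnKey_allTrivial_le`: test-function positivity of the pseudo-key
  `WeilPositivityOnKey a L₀ 1 N` ⇒ `WeilPositivityOnChar χ t` for EVERY `0 < t ≤ log(N+1)/2` and every character
  `χ mod q ≠ 1` of parity `a` with `L₀ ≤ log q` — in particular AT `t = log(N+1)/2`
  (`weilPositivityOnChar_of_weilPositivityOnKey_allTrivial_self`): ONE certificate at the all-trivial key of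
  parity `a` and level `log q₀` on `[-t, t]` proves the rung `t` for every character of parity `a` and every
  modulus `q ≥ q₀` (weil-grh-2 gen5's MINORANT plan, now loss-free);
* `ζ` side: `exists_isWeilTest_re_weilQuadratic_lt_of_lipschitz`, ★ `weilGroundEnergy_le_of_lipschitz`
  (`u ≠ 0` continuous window function on `[-b, b]`, `weilWindowForm b u ≤ B‖u‖₂² ⇒ ε(b) ≤ B` — same window),
  `not_weilPositivityOn_of_lipschitz`.
Window functions with jumps at `±b` (e.g. raw trigonometric sections) are NOT covered here (for them A33/A34's
`t > b` statements remain the typed ones).  Everything is proved; no definitions; no named facts; RH/GRH-free.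
Sources: [folklore] (dilation + dominated convergence); the forms [Bombieri2000Weil, Thm 2 p. 193;
Weil1952FormulesExplicites, (11) pp. 261–262]; statement of the application: weil-grh-2 gen5 MINORANT.md.
-/

set_option autoImplicit false

noncomputable section

open Complex Filter Set MeasureTheory

open scoped Real Topology ComplexConjugate ArithmeticFunction.vonMangoldt

namespace Summit.Ventures.WeilGRH

open Literature.NumberTheory.LFunctions
open Summit.RiemannHypothesis.RiemannHypothesis.Theorems.WeilFormatC

variable {b : ℝ} {u : ℝ → ℂ}

/-! ## Continuity of every key form along uniformly convergent window families -/

/-- **Continuity of the key form along a window family** (`w_i` measurable, `0` off `[-b, b]`, `‖w_i‖ ≤ S₀`,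
`S₁`-Lipschitz on the closed window, `‖w_i − φ‖_∞ ≤ δ_i → 0`, `b > 0`): `keyMarkovForm a L v c (w_i) →
keyMarkovForm a L v c φ` for every key `(a, L, v)` and window parameter `c` (weil-grh-1's twisted-increment and
parity-archimedean limits, assembled for abstract data). [folklore] -/
theorem tendsto_keyMarkovForm_of_uniform {w : ℕ → ℝ → ℂ} {φ : ℝ → ℂ} {S₀ S₁ : ℝ} {δ : ℕ → ℝ} (hb : 0 < b)
    (hwm : ∀ i, Measurable (w i)) (hwz : ∀ i x, x ∉ Icc (-b) b → w i x = 0) (hwb : ∀ i x, ‖w i x‖ ≤ S₀)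
    (hwl : ∀ i x y, x ∈ Icc (-b) b → y ∈ Icc (-b) b → ‖w i y - w i x‖ ≤ S₁ * |y - x|)
    (hnear : ∀ i x, ‖w i x - φ x‖ ≤ δ i) (hδ : Tendsto δ atTop (𝓝 0)) (a : ℕ) (L : ℝ) (v : ℕ → ℂ) (c : ℝ) :
    Tendsto (fun i ↦ keyMarkovForm a L v c (w i)) atTop (𝓝 (keyMarkovForm a L v c φ)) := by
  have htw : ∀ (ω : ℂ) (t : ℝ),
      Tendsto (fun i ↦ weilTwistIncrement ω (w i) t) atTop (𝓝 (weilTwistIncrement ω φ t)) :=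
    tendsto_weilTwistIncrement_of_uniform hwm hwz hwb hnear hδ
  have hprime : Tendsto (fun i ↦ ∑ n ∈ weilPrimeIndex c, (Λ n : ℝ) / Real.sqrt n *
      weilTwistIncrement (conj (v n)) (w i) (Real.log n)) atTop
      (𝓝 (∑ n ∈ weilPrimeIndex c, (Λ n : ℝ) / Real.sqrt n * weilTwistIncrement (conj (v n)) φ (Real.log n))) :=
    tendsto_finsetSum _ fun n _ ↦ (htw _ _).const_mul _
  have harch := tendsto_archIntegralPar_of_uniform hb hwm hwz hwb hwl hnear hδ a
  have hnorm := tendsto_integral_norm_sq_of_uniform hwm hwz hwb hnear hδ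
  unfold keyMarkovForm keyDirichletEnergy
  exact (hprime.add harch).sub (hnorm.const_mul _)

/-! ## The dilation family of a Lipschitz window function -/

/-- A measurable, bounded function vanishing off `[-r, r]` and Lipschitz on `ℝ` is a window function on `[-r, r]`.
[folklore] -/
theorem isWindowFunction_of_lipschitz {r : ℝ} (hm : Measurable u) (hz : ∀ x, x ∉ Icc (-r) r → u x = 0) {S : ℝ}
    (hS : ∀ x, ‖u x‖ ≤ S) {K : ℝ} (hK : ∀ x y, ‖u y - u x‖ ≤ K * |y - x|) : IsWindowFunction r u :=
  ⟨hm, hz, ⟨S, hS⟩, ⟨K, fun x y _ _ ↦ hK x y⟩⟩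

/-- The dilate `x ↦ u(c x)` (`c ≥ 1`) of a window function on `[-b, b]` vanishes off `[-b/c, b/c]`. [folklore] -/
theorem dilate_eq_zero (hu : IsWindowFunction b u) {c : ℝ} (hc : 1 ≤ c) (x : ℝ)
    (hx : x ∉ Icc (-(b / c)) (b / c)) : u (c * x) = 0 := by
  refine hu.eq_zero _ fun h ↦ hx ?_
  have hc0 : 0 < c := by linarith
  rw [mem_Icc, ← neg_div, div_le_iff₀ hc0, le_div_iff₀ hc0]
  exact ⟨by rw [mul_comm]; exact h.1, by rw [mul_comm]; exact h.2⟩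

/-- **The dilation family.**  For a window function `u` on `[-b, b]` (`b > 0`) that is `K`-Lipschitz on `ℝ`, the
dilates `u_i(x) = u(c_i x)`, `c_i = 1 + 1/(i+1)`, are window functions on windows `[-r_i, r_i]` with
`0 ≤ r_i < b`, vanish off `[-b, b]`, are uniformly bounded, uniformly `2K`-Lipschitz, and converge to `u`
uniformly (`‖u_i − u‖_∞ ≤ Kb/(i+1)`). [folklore] -/
theorem exists_dilation_family (hb : 0 < b) (hu : IsWindowFunction b u) {K : ℝ}
    (hK : ∀ x y, ‖u y - u x‖ ≤ K * |y - x|) :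
    ∃ (w : ℕ → ℝ → ℂ) (r : ℕ → ℝ) (S : ℝ) (δ : ℕ → ℝ),
      (∀ i, 0 ≤ r i ∧ r i < b) ∧ (∀ i, IsWindowFunction (r i) (w i)) ∧ (∀ i, Measurable (w i)) ∧
      (∀ i x, x ∉ Icc (-b) b → w i x = 0) ∧ (∀ i x, ‖w i x‖ ≤ S) ∧
      (∀ i x y, x ∈ Icc (-b) b → y ∈ Icc (-b) b → ‖w i y - w i x‖ ≤ 2 * K * |y - x|) ∧
      (∀ i x, ‖w i x - u x‖ ≤ δ i) ∧ Tendsto δ atTop (𝓝 0) := by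
  obtain ⟨S, hS⟩ := hu.bounded
  have hK0 : 0 ≤ K := by
    have h := (norm_nonneg _).trans (hK 0 1)
    simpa using h
  set c : ℕ → ℝ := fun i ↦ 1 + 1 / ((i : ℝ) + 1) with hc
  have hcpos : ∀ i : ℕ, 0 < 1 / ((i : ℝ) + 1) := fun i ↦ by positivity
  have hc1 : ∀ i, 1 < c i := fun i ↦ by simp only [hc]; linarith [hcpos i]
  have hc2 : ∀ i, c i ≤ 2 := fun i ↦ by
    have : 1 / ((i : ℝ) + 1) ≤ 1 := by
      rw [div_le_one (by positivity)]
      linarith [i.cast_nonneg (α := ℝ)]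
    simp only [hc]
    linarith
  set w : ℕ → ℝ → ℂ := fun i x ↦ u (c i * x) with hw
  have hwm : ∀ i, Measurable (w i) := fun i ↦ hu.measurable.comp (measurable_id.const_mul (c i))
  have hwz' : ∀ i x, x ∉ Icc (-(b / c i)) (b / c i) → w i x = 0 := fun i x hx ↦
    dilate_eq_zero hu (hc1 i).le x hx
  have hsub : ∀ i, Icc (-(b / c i)) (b / c i) ⊆ Icc (-b) b := fun i ↦ by
    have h : b / c i ≤ b := div_le_self hb.le (hc1 i).le
    exact Icc_subset_Icc (by linarith) h
  have hwz : ∀ i x, x ∉ Icc (-b) b → w i x = 0 := fun i x hx ↦ hwz' i x fun h ↦ hx (hsub i h)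
  have hwl : ∀ i x y, ‖w i y - w i x‖ ≤ 2 * K * |y - x| := by
    intro i x y
    calc ‖u (c i * y) - u (c i * x)‖ ≤ K * |c i * y - c i * x| := hK _ _
      _ = K * c i * |y - x| := by rw [← mul_sub, abs_mul, abs_of_pos (by linarith [hc1 i]), mul_assoc]
      _ ≤ 2 * K * |y - x| := by
          refine mul_le_mul_of_nonneg_right ?_ (abs_nonneg _)
          nlinarith [hc2 i]
  have hnear : ∀ i x, ‖w i x - u x‖ ≤ K * b * (1 / ((i : ℝ) + 1)) := by
    intro i x
    by_cases hx : x ∈ Icc (-b) b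
    · have hxb : |x| ≤ b := abs_le.2 ⟨hx.1, hx.2⟩
      calc ‖u (c i * x) - u x‖ ≤ K * |c i * x - x| := hK _ _
        _ = K * (1 / ((i : ℝ) + 1) * |x|) := by
            rw [show c i * x - x = 1 / ((i : ℝ) + 1) * x by simp only [hc]; ring, abs_mul,
              abs_of_pos (hcpos i)]
        _ ≤ K * b * (1 / ((i : ℝ) + 1)) := by
            rw [mul_assoc, mul_comm b]
            exact mul_le_mul_of_nonneg_left (mul_le_mul_of_nonneg_left hxb (hcpos i).le) hK0
    · rw [hu.eq_zero x hx, hwz i x hx, sub_zero, norm_zero]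
      positivity
  have hδ : Tendsto (fun i : ℕ ↦ K * b * (1 / ((i : ℝ) + 1))) atTop (𝓝 0) := by
    simpa using (tendsto_one_div_add_atTop_nhds_zero_nat (𝕜 := ℝ)).const_mul (K * b)
  refine ⟨w, fun i ↦ b / c i, S, fun i ↦ K * b * (1 / ((i : ℝ) + 1)), fun i ↦ ⟨by positivity,
    div_lt_self hb (hc1 i)⟩, fun i ↦ ?_, hwm, hwz, fun i x ↦ hS _, fun i x y _ _ ↦ hwl i x y, hnear, hδ⟩
  exact isWindowFunction_of_lipschitz (hwm i) (hwz' i) (fun x ↦ hS _) (hwl i)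

/-! ## The same-window transfer for keys -/

/-- **FROM A CONTINUOUS WINDOW FUNCTION TO A TEST FUNCTION ON THE SAME WINDOW.**  `u` a window function on
`[-b, b]` (`b > 0`), Lipschitz on `ℝ`, with `keyMarkovForm a L v b u < B‖u‖₂²`.  Then some Weil test function `g`
supported in `[-b, b]` has `keyMarkovForm a L v b g < B‖g‖₂²` (dilate, then smooth: A33). [folklore] -/
theorem exists_isWeilTest_keyMarkovForm_lt_of_lipschitz (hb : 0 < b) (hu : IsWindowFunction b u) {K : ℝ}
    (hK : ∀ x y, ‖u y - u x‖ ≤ K * |y - x|) (a : ℕ) (L : ℝ) (v : ℕ → ℂ) {B : ℝ}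
    (hB : keyMarkovForm a L v b u < B * ∫ x, ‖u x‖ ^ 2) :
    ∃ g : ℝ → ℂ, IsWeilTest g ∧ tsupport g ⊆ Icc (-b) b ∧ keyMarkovForm a L v b g < B * ∫ x, ‖g x‖ ^ 2 := by
  obtain ⟨w, r, S, δ, hr, hwin, hwm, hwz, hwb, hwl, hnear, hδ⟩ := exists_dilation_family hb hu hK
  have hform := tendsto_keyMarkovForm_of_uniform hb hwm hwz hwb hwl hnear hδ a L v b
  have hnorm := tendsto_integral_norm_sq_of_uniform hwm hwz hwb hnear hδ
  have hev : ∀ᶠ i in atTop, keyMarkovForm a L v b (w i) - B * ∫ x, ‖w i x‖ ^ 2 < 0 :=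
    (hform.sub (hnorm.const_mul B)).eventually (gt_mem_nhds (by linarith))
  obtain ⟨i, hi⟩ := hev.exists
  obtain ⟨g, hg, hsupp, hlt⟩ :=
    exists_isWeilTest_keyMarkovForm_lt (hr i).1 (hwin i) (hr i).2 a L v (B := B) (by linarith)
  exact ⟨g, hg, hsupp, hlt⟩

/-- **A negative continuous section refutes key positivity ON ITS OWN WINDOW**: `u` on `[-b, b]`, Lipschitz on
`ℝ`, `0 < b ≤ log(N+1)/2`, `keyMarkovForm a L v b u < 0` (`a ≤ 1`) ⇒ `¬ WeilPositivityOnKey a L v N`. [folklore] -/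
theorem not_weilPositivityOnKey_of_lipschitz (hb : 0 < b) (hu : IsWindowFunction b u) {K : ℝ}
    (hK : ∀ x y, ‖u y - u x‖ ≤ K * |y - x|) {N : ℕ} (hbN : b ≤ Real.log ((N : ℝ) + 1) / 2) {a : ℕ}
    (ha : a ≤ 1) (L : ℝ) (v : ℕ → ℂ) (hneg : keyMarkovForm a L v b u < 0) : ¬ WeilPositivityOnKey a L v N := by
  have hneg' : keyMarkovForm a L v b u < 0 * ∫ x, ‖u x‖ ^ 2 := by rwa [zero_mul]
  obtain ⟨g, hg, hsupp, hlt⟩ := exists_isWeilTest_keyMarkovForm_lt_of_lipschitz hb hu hK a L v hneg'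
  rw [zero_mul] at hlt
  intro hpos
  have hsupp' : tsupport g ⊆ Icc (-(Real.log ((N : ℝ) + 1) / 2)) (Real.log ((N : ℝ) + 1) / 2) :=
    hsupp.trans (Icc_subset_Icc (by linarith) hbN)
  have h := (weilPositivityOnKey_iff_keyMarkovForm_nonneg ha L v N).1 hpos g hg hsupp'
  rw [keyMarkovForm_window_eq_of_isWindowFunction (isWindowFunction_of_isWeilTest hg hsupp) hbN] at h
  linarith

/-- **Key positivity ⇒ non-negativity of the window form at every continuous window function, up to the
certificate's own window** (`0 < t ≤ log(N+1)/2`). [folklore] -/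
theorem keyMarkovForm_nonneg_of_weilPositivityOnKey_of_lipschitz {a : ℕ} (ha : a ≤ 1) {L : ℝ} {v : ℕ → ℂ}
    {N : ℕ} (hpos : WeilPositivityOnKey a L v N) {t : ℝ} (ht : 0 < t) (htN : t ≤ Real.log ((N : ℝ) + 1) / 2)
    {w : ℝ → ℂ} (hw : IsWindowFunction t w) {K : ℝ} (hK : ∀ x y, ‖w y - w x‖ ≤ K * |y - x|) :
    0 ≤ keyMarkovForm a L v t w := by
  by_contra hneg
  exact not_weilPositivityOnKey_of_lipschitz ht hw hK htN ha L v (not_le.1 hneg) hpos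

/-- `|g|` of a test function is Lipschitz on `ℝ` (mean value inequality and `| |z| − |z′| | ≤ |z − z′|`). [folklore] -/
theorem exists_lipschitz_norm_of_isWeilTest {g : ℝ → ℂ} (hg : IsWeilTest g) :
    ∃ K : ℝ, ∀ x y, ‖(((‖g y‖ : ℝ) : ℂ)) - ((‖g x‖ : ℝ) : ℂ)‖ ≤ K * |y - x| := by
  have hd : Differentiable ℝ g := hg.1.differentiable (by simp)
  obtain ⟨K, hK⟩ := (hg.1.continuous_deriv (by simp)).bounded_above_of_compact_support hg.2.deriv
  refine ⟨K, fun x y ↦ ?_⟩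
  rw [← Complex.ofReal_sub, Complex.norm_real, Real.norm_eq_abs]
  refine (abs_norm_sub_norm_le _ _).trans ?_
  rw [← Real.norm_eq_abs]
  exact convex_univ.norm_image_sub_le_of_norm_deriv_le (fun z _ ↦ hd z) (fun z _ ↦ hK z) (mem_univ x) (mem_univ y)

variable {q : ℕ}

/-- ★★ **ONE certificate at the pseudo-key, EVERY character — up to and including the certificate's window.**
`WeilPositivityOnKey a L₀ 1 N` (`a ≤ 1`) ⇒ `WeilPositivityOnChar χ t` for every `0 < t ≤ log(N+1)/2` and every
Dirichlet character `χ mod q`, `q ≠ 1`, with `charParity χ = a` and `L₀ ≤ log q` (minorant A35 at `|g|`, which is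
a continuous window function on `[-t, t]`, plus the same-window transfer). (Statement: weil-grh-2 gen5,
MINORANT.md.) [folklore] -/
theorem weilPositivityOnChar_of_weilPositivityOnKey_allTrivial_le {a : ℕ} (ha : a ≤ 1) {L₀ : ℝ} {N : ℕ}
    (hpos : WeilPositivityOnKey a L₀ (fun _ ↦ 1) N) {t : ℝ} (ht : 0 < t) (htN : t ≤ Real.log ((N : ℝ) + 1) / 2)
    (hq : q ≠ 1) (χ : DirichletCharacter ℂ q) (hpar : charParity χ = a) (hL : L₀ ≤ Real.log q) :
    WeilPositivityOnChar χ t := by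
  intro g hg hsupp
  have h := keyMarkovForm_allTrivial_le_re_weilQuadraticChar hq χ hg ht.le hsupp hL
  rw [hpar] at h
  obtain ⟨K, hK⟩ := exists_lipschitz_norm_of_isWeilTest hg
  exact (keyMarkovForm_nonneg_of_weilPositivityOnKey_of_lipschitz ha hpos ht htN
    (isWindowFunction_norm (isWindowFunction_of_isWeilTest hg hsupp)) hK).trans h

/-- ★ The headline instance of the previous theorem AT the certificate's window `t = log(N+1)/2` (`N ≥ 1`).
[folklore] -/
theorem weilPositivityOnChar_of_weilPositivityOnKey_allTrivial_self {a : ℕ} (ha : a ≤ 1) {L₀ : ℝ} {N : ℕ}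
    (hN : 1 ≤ N) (hpos : WeilPositivityOnKey a L₀ (fun _ ↦ 1) N) (hq : q ≠ 1) (χ : DirichletCharacter ℂ q)
    (hpar : charParity χ = a) (hL : L₀ ≤ Real.log q) :
    WeilPositivityOnChar χ (Real.log ((N : ℝ) + 1) / 2) := by
  have hN' : (1 : ℝ) < (N : ℝ) + 1 := by
    have : (1 : ℝ) ≤ N := by exact_mod_cast hN
    linarith
  exact weilPositivityOnChar_of_weilPositivityOnKey_allTrivial_le ha hpos
    (div_pos (Real.log_pos hN') two_pos) le_rfl hq χ hpar hL

/-- The same with the pseudo-key read off a character `χ₀ mod q₀` (`(charParity χ₀, log q₀, 1)`): every character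
of the same parity and modulus `q ≥ q₀`, every window `0 < t ≤ log(N+1)/2`. [folklore] -/
theorem weilPositivityOnChar_of_weilPositivityOnKey_allTrivial_mod_le {q₀ : ℕ} (χ₀ : DirichletCharacter ℂ q₀)
    {N : ℕ} (hpos : WeilPositivityOnKey (charParity χ₀) (Real.log q₀) (fun _ ↦ 1) N) {t : ℝ} (ht : 0 < t)
    (htN : t ≤ Real.log ((N : ℝ) + 1) / 2) (hq : q ≠ 1) (χ : DirichletCharacter ℂ q)
    (hpar : charParity χ = charParity χ₀) (hqq : q₀ ≤ q) (hq₀ : q₀ ≠ 0) : WeilPositivityOnChar χ t :=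
  weilPositivityOnChar_of_weilPositivityOnKey_allTrivial_le (charParity_le_one χ₀) hpos ht htN hq χ hpar
    (Real.log_le_log (by exact_mod_cast Nat.pos_of_ne_zero hq₀) (by exact_mod_cast hqq))

/-! ## The same-window transfer for `ζ` -/

/-- **FROM A CONTINUOUS WINDOW FUNCTION TO A TEST FUNCTION ON THE SAME WINDOW, `ζ` version.**  `u` a window
function on `[-b, b]` (`b > 0`), Lipschitz on `ℝ`, `‖u‖₂ > 0`, `weilWindowForm b u < B‖u‖₂²` ⇒ a Weil test function
`g` on `[-b, b]` with `Re Q(g) < B‖g‖₂²` and `‖g‖₂ > 0`. [folklore] -/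
theorem exists_isWeilTest_re_weilQuadratic_lt_of_lipschitz (hb : 0 < b) (hu : IsWindowFunction b u) {K : ℝ}
    (hK : ∀ x y, ‖u y - u x‖ ≤ K * |y - x|) (hu0 : 0 < ∫ x, ‖u x‖ ^ 2) {B : ℝ}
    (hB : weilWindowForm b u < B * ∫ x, ‖u x‖ ^ 2) :
    ∃ g : ℝ → ℂ, IsWeilTest g ∧ tsupport g ⊆ Icc (-b) b ∧ (weilQuadratic g).re < B * ∫ x, ‖g x‖ ^ 2 ∧
      0 < ∫ x, ‖g x‖ ^ 2 := by
  obtain ⟨w, r, S, δ, hr, hwin, hwm, hwz, hwb, hwl, hnear, hδ⟩ := exists_dilation_family hb hu hK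
  have hform := tendsto_weilWindowForm_of_uniform hb hwm hwz hwb hwl hnear hδ
  have hnorm := tendsto_integral_norm_sq_of_uniform hwm hwz hwb hnear hδ
  have hev : ∀ᶠ i in atTop, weilWindowForm b (w i) - B * ∫ x, ‖w i x‖ ^ 2 < 0 :=
    (hform.sub (hnorm.const_mul B)).eventually (gt_mem_nhds (by linarith))
  have hev' : ∀ᶠ i in atTop, (∫ x, ‖u x‖ ^ 2) / 2 < ∫ x, ‖w i x‖ ^ 2 :=
    hnorm.eventually (lt_mem_nhds (by linarith))
  obtain ⟨i, hi, hi'⟩ := (hev.and hev').exists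
  obtain ⟨g, hg, hsupp, hlt, hN⟩ := exists_isWeilTest_re_weilQuadratic_lt (hr i).1 (hwin i) (hr i).2 (B := B)
    (by linarith) (half_pos hu0)
  refine ⟨g, hg, hsupp, hlt, ?_⟩
  have := (abs_lt.1 hN).1
  linarith

/-- ★ **EVERY CONTINUOUS SECTION RAYLEIGH QUOTIENT BOUNDS THE GROUND ENERGY OF ITS OWN WINDOW FROM ABOVE**:
`u` a window function on `[-b, b]` (`b > 0`), Lipschitz on `ℝ`, `‖u‖₂ > 0`, `weilWindowForm b u ≤ B‖u‖₂²` ⇒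
`ε(b) = weilGroundEnergy b ≤ B`. [cite: Suzuki2026, Cor. 1.2] -/
theorem weilGroundEnergy_le_of_lipschitz (hb : 0 < b) (hu : IsWindowFunction b u) {K : ℝ}
    (hK : ∀ x y, ‖u y - u x‖ ≤ K * |y - x|) (hu0 : 0 < ∫ x, ‖u x‖ ^ 2) {B : ℝ}
    (hB : weilWindowForm b u ≤ B * ∫ x, ‖u x‖ ^ 2) : weilGroundEnergy b ≤ B := by
  refine le_of_forall_gt_imp_ge_of_dense fun B' hB' ↦ ?_
  have hlt : weilWindowForm b u < B' * ∫ x, ‖u x‖ ^ 2 := hB.trans_lt (mul_lt_mul_of_pos_right hB' hu0)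
  obtain ⟨g, hg, hsupp, hQ, hNg⟩ := exists_isWeilTest_re_weilQuadratic_lt_of_lipschitz hb hu hK hu0 hlt
  have h := weilGroundEnergy_le_div hg hsupp hNg
  have h' : (weilQuadratic g).re / ∫ x, ‖g x‖ ^ 2 < B' := (div_lt_iff₀ hNg).2 hQ
  exact h.trans h'.le

/-- **A negative continuous section refutes `ζ`-positivity on its own window**: `u` on `[-b, b]` (`b > 0`),
Lipschitz on `ℝ`, `‖u‖₂ > 0`, `weilWindowForm b u < 0 ⇒ ¬ WeilPositivityOn b`. [folklore] -/
theorem not_weilPositivityOn_of_lipschitz (hb : 0 < b) (hu : IsWindowFunction b u) {K : ℝ}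
    (hK : ∀ x y, ‖u y - u x‖ ≤ K * |y - x|) (hu0 : 0 < ∫ x, ‖u x‖ ^ 2) (hneg : weilWindowForm b u < 0) :
    ¬ WeilPositivityOn b := by
  have hlt : weilWindowForm b u < 0 * ∫ x, ‖u x‖ ^ 2 := by rwa [zero_mul]
  obtain ⟨g, hg, hsupp, hQ, -⟩ := exists_isWeilTest_re_weilQuadratic_lt_of_lipschitz hb hu hK hu0 hlt
  rw [zero_mul] at hQ
  intro hpos
  have h := hpos g hg hsupp
  linarith

end Summit.Ventures.WeilGRH

end
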